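import Summits.ResolutionOfSingularities.ResolutionOfSingularities.Theorems.EquisingularLiftEquisingularLiftNatP1VBProjectiveLine
import Summits.ResolutionOfSingularities.ResolutionOfSingularities.Theorems.EquisingularLiftEquisingularLiftNatP1VBNowhereVanishing
import Literature.AlgebraicGeometry.Modules.IsoOfSectionsOnBasis
import Literature.AlgebraicGeometry.Modules.CokernelSupport
import Literature.AlgebraicGeometry.Modules.VectorBundleFiniteLocallyFree
import HarnessLib

/-!
# [OURS · L1 W4.5(b) · T-P1VB part 5] The sub-line-bundle of a nowhere-vanishing section (local retractions, `𝒪 → F` mono)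
# and the v8 SUPPLIER CORE on `ℙ¹`: nowhere-vanishing sections lift from `ℙ¹_k` to `ℙ¹_O` when `Ȟ¹` vanishes

Cell res-hironaka, LADDER-RESOLUTION rung L (D-0089), slot W4.5(b), crux `Theses.EquisingularLift.EquisingularLiftNat`
(stmt-ResolutionOfSingularities-20038) / child `EquisingularLiftNatThree` (stmt-ResolutionOfSingularities-20148); object **T-P1VB**
(res-L1-w45b-lead-2 BOOK 2026-08-27T09:28:20Z, rung v8 DIR₀ of LEAD-MEMO-5: «a lift of a nowhere-vanishing section is nowhere
vanishing on the proper ℙ¹_O ⇒ L := the sub-line-bundle it spans»), `--supports stmt-ResolutionOfSingularities-20148 --as helper`.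
NOT a statement of any manuscript; OURS. AI-written; AI review is weaker than expert review.

WHAT.
* `IsNowhereVanishing.exists_retraction` — a nowhere-vanishing `s` is LOCALLY A DIRECT SUMMAND: around every point a linear form
  `μ : F|_W → 𝒪|_W` with `μ(s|_W) = 1` (`W = D(λ_i(s))`, `μ = λ_i(s)⁻¹ λ_i`; tree `Modules/LocalFrames`, `Modules/SheafHom.restrictHom`);
* `sectionHom F s : 𝒪_X → F` [OURS def], `a ↦ a · s|` (Mathlib `SheafOfModules.unitHomEquiv`), `sectionHom_app`;
  **`mono_sectionHom`** — it is a monomorphism for `s` nowhere vanishing (so `𝒪_X · s ≅ 𝒪_X` is a sub-line-bundle of `F`,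
  locally split by `exists_retraction`);
* **`exists_nowhereVanishing_lift`** (parts 2b + 4) — `A` Noetherian local, `φ : A → B` onto a non-zero ring, `f : X → Spec A`
  proper, `g` the base change, `X = U₀ ∪ U₁` two affine charts with affine intersection, `F` a vector bundle with
  `Ȟ¹((g⁻¹U₀, g⁻¹U₁); g^*F) = 0`: every nowhere-vanishing global section of `g^*F` is `η(σ)` for a nowhere-vanishing `σ ∈ Γ(X, F)`;
* **`exists_nowhereVanishing_lift_projectiveLine`** — the instance `ℙ¹_A ⊇ ℙ¹_k` (`ProjCech.PP`, `Proj.map (mapGraded A k (Fin 2))`,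
  standard charts `Dplus k 1 {i}`): THE v8 SUPPLIER CORE «σ₀ ∈ Γ(ℙ¹_k, F_k) nowhere vanishing ∧ Ȟ¹(ℙ¹_k; F_k) = 0 ⇒
  ∃ σ ∈ Γ(ℙ¹_O, F) nowhere vanishing with η(σ) = σ₀», unconditional, no completeness of `O`. Applied to `F = 𝒩(−ℓ)`: a
  sub-line-bundle `L₀ ≅ 𝒪(ℓ)` of `𝒩_k` with `H¹(ℙ¹_k, 𝒩_k(−ℓ)) = 0` lifts to a sub-line-bundle of `𝒩`.
Not here (follow-ups if booked): finite local freeness of `coker (sectionHom F s)`; the numerical dictionary «deg det 𝒩_k − 2 deg L₀ ≥ −1»;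
the chartwise «section curve of e_C ↔ nowhere-vanishing section» dictionary (needs E_C ≅ ℙ(𝒩), not in the tree globally).

References (index only): Hartshorne II.5, II Ex. 5.1; The Stacks Project, Tag 01C6; Mathlib `SheafOfModules.unitHomEquiv`.
-/

noncomputable section

-- `TopCat.Presheaf`/`Scheme.Modules` are not reducible (as in Mathlib's `AlgebraicGeometry/Modules`).
set_option backward.isDefEq.respectTransparency false

open CategoryTheory AlgebraicGeometry Limits TopologicalSpace Opposite
open Literature.AlgebraicGeometry.Modules Literature.AlgebraicGeometry.Morphisms Literature.AlgebraicGeometry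
open Literature.AlgebraicGeometry.Motives.ProjBaseChangeRing (mapGraded irrelevant_le_map isPullback_projMap'
  isProper_projToSpec)

universe u

attribute [local instance] MvPolynomial.gradedAlgebra

set_option linter.dupNamespace false -- mandated namespace `Summit.<Summit>.<Problem>` of this single-conjunct summit

namespace Summit.ResolutionOfSingularities.ResolutionOfSingularities.Cruxes.EquisingularLiftNat.P1VB

/-! ### Local retractions: `𝒪_X · s ⊆ F` is locally a direct summand -/

section Retraction

variable {X : Scheme.{u}} {F : X.Modules} {s : Γ(F, ⊤)}

/-- **A nowhere-vanishing section is locally a direct summand**: around every point there is a local linear form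
`λ : F|_W → 𝒪|_W` with `λ(s|_W) = 1` (on `W = D(λ_i(s))`, `λ = λ_i(s)⁻¹ · λ_i`). [folklore] -/
theorem IsNowhereVanishing.exists_retraction (hs : IsNowhereVanishing F s) (x : X) :
    ∃ (W : X.Opens) (_ : x ∈ W) (μ : F.over W ⟶ (unitModule X).over W),
      @Eq Γ(X, W) (appLE μ (𝟙 W) (F.presheaf.map (homOfLE (le_top : W ≤ ⊤)).op s)) 1 := by
  obtain ⟨W₀, hx, I, hI, e, i, hi⟩ := hs x
  set c : Γ(X, W₀) := coord e (𝟙 W₀) (F.presheaf.map (homOfLE (le_top : W₀ ≤ ⊤)).op s) i with hc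
  have hle : X.basicOpen c ≤ W₀ := X.basicOpen_le c
  obtain ⟨u, hu⟩ := isUnit_map_of_le_basicOpen c (le_refl (X.basicOpen c))
  refine ⟨X.basicOpen c, hi, (↑u⁻¹ : Γ(X, X.basicOpen c)) • restrictHom (homOfLE hle) (dualBasis e i), ?_⟩
  rw [appLE_smul, appLE_restrictHom, Category.id_comp, ← coord_def]
  have hcoord : coord e (homOfLE hle) (F.presheaf.map (homOfLE (le_top : X.basicOpen c ≤ ⊤)).op s) i =
      X.presheaf.map (homOfLE hle).op c := by
    have h := coord_map e (𝟙 W₀) (homOfLE hle) (F.presheaf.map (homOfLE (le_top : W₀ ≤ ⊤)).op s) i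
    rw [Category.comp_id, ← CategoryTheory.comp_apply, ← Functor.map_comp] at h
    exact h
  rw [hcoord]
  have hid : X.presheaf.map (𝟙 (X.basicOpen c)).op (↑u⁻¹ : Γ(X, X.basicOpen c)) = ↑u⁻¹ := by
    rw [op_id, X.presheaf.map_id]; rfl
  rw [hid]
  change (↑u⁻¹ : Γ(X, X.basicOpen c)) * X.presheaf.map (homOfLE hle).op c = 1
  rw [← hu, Units.inv_mul]

end Retraction

/-! ### The morphism `𝒪_X → F` of a global section; it is a monomorphism for a nowhere-vanishing section -/

section SectionHom

variable {X : Scheme.{u}} (F : X.Modules) (s : Γ(F, ⊤))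

/-- **[OURS] The morphism `σ_s : 𝒪_X → F`, `a ↦ a · s|`, of a global section `s`** (Mathlib `unitHomEquiv`).
[folklore] -/
def sectionHom : unitModule X ⟶ F :=
  F.unitHomEquiv.symm
    (PresheafOfModules.sectionsMk (M := F.val) (fun U => F.presheaf.map (homOfLE (le_top : U.unop ≤ ⊤)).op s)
      fun U V i => by
        change (F.presheaf.map (homOfLE (le_top : U.unop ≤ ⊤)).op ≫ F.presheaf.map i) s =
          F.presheaf.map (homOfLE (le_top : V.unop ≤ ⊤)).op s
        rw [← Functor.map_comp]
        rfl)

/-- Sections of `σ_s`: `a ↦ a • s|_W`. [folklore] -/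
theorem sectionHom_app (W : X.Opens) (a : Γ(X, W)) :
    (sectionHom F s).app W a = a • F.presheaf.map (homOfLE (le_top : W ≤ ⊤)).op s := rfl

variable {F s}

/-- **`σ_s : 𝒪_X → F` is a monomorphism for `s` nowhere vanishing** (`a · s = 0 ⇒ a = 0` locally, by a local
retraction). [folklore] -/
theorem mono_sectionHom (hs : IsNowhereVanishing F s) : Mono (sectionHom F s) := by
  refine mono_of_injective_app_of_isAffineOpen _ fun V _ => ?_
  rw [injective_iff_map_eq_zero]
  intro a ha
  rw [sectionHom_app] at ha
  -- cover `V` by the opens `V ∩ W_x` carrying retractions `μ_x`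
  choose W hxW μ hμ using fun x : V => hs.exists_retraction (x : X)
  refine X.sheaf.eq_of_locally_eq' (fun x : V => V ⊓ W x) V (fun x => homOfLE inf_le_left)
    (fun y hy => Opens.mem_iSup.mpr ⟨⟨y, hy⟩, hy, hxW ⟨y, hy⟩⟩) a 0 fun x => ?_
  rw [map_zero]
  change X.presheaf.map (homOfLE (inf_le_left : V ⊓ W x ≤ V)).op a = 0
  -- `r := μ_x(s|) = 1` over `V ∩ W_x`
  set r : Γ(X, V ⊓ W x) := appLE (μ x) (homOfLE (inf_le_right : V ⊓ W x ≤ W x))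
      (F.presheaf.map (homOfLE (le_top : V ⊓ W x ≤ ⊤)).op s) with hr
  have h1 : r = 1 := by
    have h := appLE_map (μ x) (𝟙 (W x)) (homOfLE (inf_le_right : V ⊓ W x ≤ W x))
      (F.presheaf.map (homOfLE (le_top : W x ≤ ⊤)).op s)
    rw [Category.comp_id, ← CategoryTheory.comp_apply, ← Functor.map_comp] at h
    change r = X.presheaf.map (homOfLE (inf_le_right : V ⊓ W x ≤ W x)).op
      (appLE (μ x) (𝟙 (W x)) (F.presheaf.map (homOfLE (le_top : W x ≤ ⊤)).op s)) at h
    rw [h, hμ, map_one]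
  -- restrict `a • s| = 0` to `V ∩ W_x` and apply `μ_x`
  have h2 := congrArg (fun t => appLE (μ x) (homOfLE (inf_le_right : V ⊓ W x ≤ W x))
    (F.presheaf.map (homOfLE (inf_le_left : V ⊓ W x ≤ V)).op t)) ha
  simp only [map_zero, appLE_zero_right, Scheme.Modules.map_smul] at h2
  rw [← CategoryTheory.comp_apply, ← Functor.map_comp, appLE_smul_right] at h2
  have h4 : X.presheaf.map (homOfLE (inf_le_left : V ⊓ W x ≤ V)).op a * r = 0 := h2
  rwa [h1, mul_one] at h4

end SectionHom

/-! ### The supplier core: nowhere-vanishing sections lift (general two-chart setting, then `ℙ¹`) -/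

section Lift

variable {A B : Type u} [CommRing A] [IsNoetherianRing A] [IsLocalRing A] [CommRing B] [Nontrivial B] (φ : A →+* B)
  {X Y : Scheme.{u}} (f : X ⟶ Spec (.of A)) [IsProper f] {g : Y ⟶ X} {t : Y ⟶ Spec (.of B)}
  (U : Fin 2 → X.Opens) (F : X.Modules)

/-- **Nowhere-vanishing sections lift** (parts 2b + 4): in the setting of `exists_unitSection_eq` (A Noetherian local,
`φ : A → B` onto a non-zero ring, `f` proper, `X = U₀ ∪ U₁` with `U₀, U₁, U₀ ∩ U₁` affine, `F` a vector bundle,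
`Ȟ¹((g⁻¹U₀, g⁻¹U₁); g^*F) = 0`), every nowhere-vanishing global section of `g^*F` is `η(σ)` for a nowhere-vanishing
global section `σ` of `F`. [folklore] -/
theorem exists_nowhereVanishing_lift (hφ : Function.Surjective φ)
    (H : IsPullback g t f (Spec.map (CommRingCat.ofHom φ))) (hF : Motives.IsVectorBundle F)
    (hU : ∀ i, IsAffineOpen (U i)) (hU01 : IsAffineOpen (U 0 ⊓ U 1)) (hcov : ⨆ i, U i = ⊤)
    (h1 : Subsingleton (CechMH1 t ((Scheme.Modules.pullback g).obj F) (fun i => g ⁻¹ᵁ U i)))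
    (σ₀ : Γ((Scheme.Modules.pullback g).obj F, g ⁻¹ᵁ ⊤))
    (hσ₀ : IsNowhereVanishing ((Scheme.Modules.pullback g).obj F) σ₀) :
    ∃ σ : Γ(F, ⊤), unitSection g F ⊤ σ = σ₀ ∧ IsNowhereVanishing F σ := by
  obtain ⟨σ, hσ⟩ := exists_unitSection_eq f U φ F hφ H hF hU hU01 hcov h1 σ₀
  refine ⟨σ, hσ, IsNowhereVanishing.of_unitSection φ f hφ H (isFiniteLocallyFree_of_isVectorBundle hF) σ ?_⟩
  rw [hσ]
  exact hσ₀

end Lift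

section ProjectiveLine

variable {A k : Type u} [CommRing A] [IsNoetherianRing A] [IsLocalRing A] [CommRing k] [Nontrivial k]
  [Algebra A k]

/-- **T-P1VB (v8 supplier core on `ℙ¹`)**: `A` Noetherian local, `A → k` onto a non-zero ring, `g : ℙ¹_k → ℙ¹_A` the
special-fibre inclusion, `F` a vector bundle on `ℙ¹_A` with `Ȟ¹ = 0` for `g^*F` on the two standard charts of `ℙ¹_k`.
Then every NOWHERE-VANISHING global section `σ₀` of `g^*F` is the pull-back `η(σ)` of a NOWHERE-VANISHING global
section `σ` of `F` (so `σ : 𝒪 → F` is a monomorphism, locally a direct summand: `mono_sectionHom`,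
`IsNowhereVanishing.exists_retraction`). With `F = 𝒩(−ℓ)`: a sub-line-bundle `𝒪(ℓ) ≅ L₀ ⊆ 𝒩_k` with `H¹(𝒩_k(−ℓ)) = 0`
lifts to one of `𝒩` on `ℙ¹_A`. No completeness of `A`. [folklore] -/
theorem exists_nowhereVanishing_lift_projectiveLine (hπ : Function.Surjective (algebraMap A k))
    (F : (ProjCech.PP A 1).Modules) (hF : Motives.IsVectorBundle F)
    (h1 : Subsingleton (CechMH1 (ProjCech.toSpec k 1)
      ((Scheme.Modules.pullback (Proj.map (mapGraded A k (Fin 2)) (irrelevant_le_map A k (Fin 2)))).obj F)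
      (fun i : Fin 2 => ProjCech.Dplus k 1 {i})))
    (σ₀ : Γ((Scheme.Modules.pullback (Proj.map (mapGraded A k (Fin 2)) (irrelevant_le_map A k (Fin 2)))).obj F,
      Proj.map (mapGraded A k (Fin 2)) (irrelevant_le_map A k (Fin 2)) ⁻¹ᵁ ⊤))
    (hσ₀ : IsNowhereVanishing _ σ₀) :
    ∃ σ : Γ(F, ⊤), unitSection (Proj.map (mapGraded A k (Fin 2)) (irrelevant_le_map A k (Fin 2))) F ⊤ σ = σ₀ ∧
      IsNowhereVanishing F σ := by
  haveI : IsProper (ProjCech.toSpec A 1) := isProper_projToSpec (Fin 2) A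
  have hcharts : (fun i : Fin 2 => Proj.map (mapGraded A k (Fin 2)) (irrelevant_le_map A k (Fin 2)) ⁻¹ᵁ
      ProjCech.Dplus A 1 {i}) = fun i : Fin 2 => ProjCech.Dplus k 1 {i} :=
    funext fun i => projMap_preimage_Dplus A 1 k {i}
  have h1' : Subsingleton (CechMH1 (ProjCech.toSpec k 1)
      ((Scheme.Modules.pullback (Proj.map (mapGraded A k (Fin 2)) (irrelevant_le_map A k (Fin 2)))).obj F)
      (fun i : Fin 2 => Proj.map (mapGraded A k (Fin 2)) (irrelevant_le_map A k (Fin 2)) ⁻¹ᵁ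
        ProjCech.Dplus A 1 {i})) := by
    rw [hcharts]; exact h1
  exact exists_nowhereVanishing_lift (algebraMap A k) (ProjCech.toSpec A 1) (fun i : Fin 2 => ProjCech.Dplus A 1 {i}) F hπ
    (isPullback_projMap' A k) hF (fun i => isAffineOpen_Dplus_singleton A 1 i)
    (isAffineOpen_Dplus_singleton_inf A 1 0 1) (iSup_Dplus_singleton_eq_top A 1) h1' σ₀ hσ₀

end ProjectiveLine

end Summit.ResolutionOfSingularities.ResolutionOfSingularities.Cruxes.EquisingularLiftNat.P1VB

end
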